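import Summits.Ventures.DiscreteObjects.Hadamard.Order167Normalizer668
import Summits.Ventures.DiscreteObjects.Hadamard.Order83Normalizer668
import Summits.Ventures.DiscreteObjects.Hadamard.Order333NormalizerIff668
import Summits.Ventures.DiscreteObjects.Hadamard.Order37Normalizer668
import Summits.Ventures.DiscreteObjects.Hadamard.Order23Normalizer668

/-!
# H(668): how the large prime-power elements of Aut± can be normalised — ONE statement (kernel summary of hadamard gen 20)

Framing: lottery ticket; floor = certified bounds/negative ranges.

Cell pub-namedobj (venture DiscreteObjects), target (H), hadamard gen 20.  For a Hadamard matrix `H` of order `668`, a signed automorphism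
`σ = (π, κ, d, e)` and a signed automorphism `τ = (π', κ', d', e')` NORMALISING its permutation pair with multiplier `μ`
(`π'π = π^μ π'`, `κ'κ = κ^μ κ'`), **`hadamard668_normalizers_summary`** packages (nothing new is proved here):
1. `σ` of pair order `167` (`π^167 = κ^167 = 1`, `(π,κ) ≠ 1`): `μ² ≡ 1 (mod 167)` — EVERY normalising automorphism acts as `±1`
   (`Order167Normalizer668`; no `C₁₆₇ ⋊ C₈₃`);
2. `σ` of pair order `83`: `μ² ≡ 1 (mod 83)` (`Order83Normalizer668`; no `C₈₃ ⋊ C₄₁`);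
3. `σ` of pair order `333` (`π^333 = κ^333 = 1`, `(π^111,κ^111) ≠ 1 ≠ (π^9,κ^9)`): `τ` preserves all four cores or none, and in either
   case a Legendre pair of length `333` invariant under `μ²` exists; if `τ` keeps a free row in its core, one invariant under `μ` exists
   (`Order333Normalizer668`, `Order333NormalizerIff668`; the converse realisation and the `iff` are there);
4. `σ` of pair order `37`, `τ` keeping a free row and every free column in its orbit: no power of `μ` is `4` or `8 (mod 37)`
   (`Order37Normalizer668`);
5. `σ` of pair order `23`, `τ` keeping a free row and every free column in its orbit: `μ² ≡ 1 (mod 23)` (`Order23Normalizer668`).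
Structure / exclusions of symmetry types of a HYPOTHETICAL object; no automorphism order and no Hadamard order is excluded; H(668)
untouched; HITS 0/4.  Ours; no `sorry`, no definitions.
-/

namespace Summit.Ventures.DiscreteObjects.Hadamard

open Finset BigOperators Matrix

open Literature.Combinatorics.Designs.GoethalsSeidel (IsHadamardMatrix)
open Literature.Combinatorics.Designs.LegendrePairs (LegendrePair HInvariant)

variable {ι : Type*} [Fintype ι] [DecidableEq ι]

/-- **Normalisers of the elements of order 167, 83, 333, 37, 23 of Aut± of a hypothetical H(668) — kernel summary** (see the module
docstring; conjuncts 1–5 in that order). -/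
theorem hadamard668_normalizers_summary {H : Matrix ι ι ℤ} (hH : IsHadamardMatrix H) (hι : Fintype.card ι = 668)
    {π κ π' κ' : Equiv.Perm ι} {d e d' e' : ι → ℤ} (haut : IsSignedAut H π κ d e) (haut' : IsSignedAut H π' κ' d' e')
    {μ : ℕ} (hnπ : π' * π = π ^ μ * π') (hnκ : κ' * κ = κ ^ μ * κ') :
    (π ^ 167 = 1 → κ ^ 167 = 1 → (π ≠ 1 ∨ κ ≠ 1) → (μ : ZMod 167) ^ 2 = 1) ∧
    (π ^ 83 = 1 → κ ^ 83 = 1 → (π ≠ 1 ∨ κ ≠ 1) → (μ : ZMod 83) ^ 2 = 1) ∧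
    (π ^ 333 = 1 → κ ^ 333 = 1 → (π ^ 111 ≠ 1 ∨ κ ^ 111 ≠ 1) → (π ^ 9 ≠ 1 ∨ κ ^ 9 ≠ 1) →
      (((∀ x, π x ≠ x → π' x ∈ orbFin π 333 x) ∧ (∀ y, κ y ≠ y → κ' y ∈ orbFin κ 333 y)) ∨
        ((∀ x, π x ≠ x → π' x ∉ orbFin π 333 x) ∧ (∀ y, κ y ≠ y → κ' y ∉ orbFin κ 333 y))) ∧
      (∃ (u : (ZMod 333)ˣ) (a b : ZMod 333 → ℤ), (u : ZMod 333) = (μ : ZMod 333) ∧ LegendrePair a b ∧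
        HInvariant a (u ^ 2) ∧ HInvariant b (u ^ 2)) ∧
      (∀ x₀, π x₀ ≠ x₀ → π' x₀ ∈ orbFin π 333 x₀ →
        ∃ (u : (ZMod 333)ˣ) (a b : ZMod 333 → ℤ), (u : ZMod 333) = (μ : ZMod 333) ∧ LegendrePair a b ∧
          HInvariant a u ∧ HInvariant b u)) ∧
    (π ^ 37 = 1 → κ ^ 37 = 1 → (π ≠ 1 ∨ κ ≠ 1) → ∀ x₀, π x₀ ≠ x₀ → π' x₀ ∈ orbFin π 37 x₀ →
      (∀ y, κ y ≠ y → κ' y ∈ orbFin κ 37 y) → ∀ k : ℕ, (μ : ZMod 37) ^ k ≠ 4 ∧ (μ : ZMod 37) ^ k ≠ 8) ∧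
    (π ^ 23 = 1 → κ ^ 23 = 1 → (π ≠ 1 ∨ κ ≠ 1) → ∀ x₀, π x₀ ≠ x₀ → π' x₀ ∈ orbFin π 23 x₀ →
      (∀ y, κ y ≠ y → κ' y ∈ orbFin κ 23 y) → (μ : ZMod 23) ^ 2 = 1) := by
  refine ⟨fun hπ hκ hne => ?_, fun hπ hκ hne => ?_, fun hπ hκ h111 h9 => ⟨?_, ?_, fun x₀ hx₀ hmem => ?_⟩,
    fun hπ hκ hne x₀ hx₀ hrow hcols k => ⟨?_, ?_⟩, fun hπ hκ hne x₀ hx₀ hrow hcols => ?_⟩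
  · exact hadamard668_order167_normalizer_sq_eq_one_general hH hι haut hπ hκ hne haut' hnπ hnκ
  · exact hadamard668_order83_normalizer_sq_eq_one_general hH hι haut hπ hκ hne haut' hnπ hnκ
  · exact hadamard668_order333_normalizing_all_or_none hH hι haut hπ hκ h111 h9 haut' hnπ hnκ
  · exact hadamard668_order333_normalizer_sq hH hι haut hπ hκ h111 h9 haut' hnπ hnκ
  · exact hadamard668_order333_normalizer_multiplier hH hι haut hπ hκ h111 h9 haut' hnπ hnκ hx₀ hmem
  · exact hadamard668_order37_normalizer_not_square_generator hH hι haut hπ hκ hne haut' hnπ hnκ hx₀ hrow hcols k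
  · exact hadamard668_order37_normalizer_not_index3_generator hH hι haut hπ hκ hne haut' hnπ hnκ hx₀ hrow hcols k
  · exact hadamard668_order23_normalizer_sq_eq_one hH hι haut hπ hκ hne haut' hnπ hnκ hx₀ hrow hcols

end Summit.Ventures.DiscreteObjects.Hadamard
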